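import Summits.AtomisticToContinuum.Crystallization.Theorems.FreeSplittingCertificatesRadiusLadderRationalCrux
import Summits.AtomisticToContinuum.Crystallization.Theorems.FreeSplittingCertificatesRadiusLadderStar563
import Summits.AtomisticToContinuum.Crystallization.Theorems.FreeSplittingCertificatesRadiusLadderStar799

/-!
# Radius ladder for `FiniteRangeSplitting`: the RADIUS FLOOR `R ≥ δ_½` below the half-rule threshold

Route `FreeSplittingCertificates`, crux r2 `FiniteRangeSplitting` (stmt-AtomisticToContinuum-12559); block-2b unit
`b2b-freesplit`, PART A gen 17.  Value = structural theorems about the crux's instances — NOT summit progress.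
(The `ε`-analogue for crux r5 is `…RadiusLadderRadiusFloorApprox`.)

The blind-rule averaging of `…RadiusLadderHalfRuleIff` (`halfSumFeasible_of_rungAt`: for `R < δ` a rung at `(δ, R)`
IS the deepest-site inequality `HalfSumFeasible δ`) only needs the TEST configurations to be separated beyond the
radius, not the hard core: a rung at `(δ, R)` is a rung at every larger hard core `s ≥ δ` (`rungAt_mono_sep`), and on
`s`-separated configurations with `s > R` every bond pattern is the trivial `{0, v}` (`bondPattern_of_lt_sep`), so ANY
feasible rule is averaged to the half rule there (`eInf_le_half_sum_of_symmetric`).  Hence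
(`halfSumThreshold_le_max_of_rungAt`)

  `RungAt δ R`, `δ > 0`  ⟹  `δ_½ ≤ max δ R`,

i.e. the rung region misses the whole open square `(0, δ_½) × [0, δ_½)` and not only its part `R < δ` under the
diagonal (`not_rungAt_of_lt_threshold`, `radius_ge_of_rungAt`): BELOW THE HALF-RULE THRESHOLD EVERY RUNG READS
PATTERNS OF RADIUS `R ≥ δ_½ ≥ 47/50` (`threshold_le_radius_of_rungAt`), whatever the hard core.  Consequences, all
unconditional and free of the `e_∞` bracket:

* `sepThreshold_eq_halfSumThreshold_of_lt_threshold` — the closed form `δ*(R) = δ_½` holds for EVERY `R < δ_½`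
  (tree: `R < 47/50`, `sepThreshold_eq_halfSumThreshold_of_lt`); a threshold `δ*(R) < δ_½` forces `R ≥ δ_½`
  (`threshold_le_of_sepThreshold_lt`), so crux r2 is `∃ R ≥ δ_½, δ*(R) = 0`
  (`finiteRangeSplitting_iff_exists_sepThreshold_eq_zero_floor`) and its failure is `∀ R ≥ δ_½, δ*(R) ≥ 2/5`;
* `threshold_le_radThreshold_of_lt_threshold`, `radThreshold_eq_zero_or_threshold_le`, `radThreshold_eq_zero_iff`,
  `radThreshold_not_mem_Ioo` — the minimal rung radius `R*` takes NO value in `(0, δ_½)`: `R*(δ) = 0` iff `δ ≥ δ_½`,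
  else `R*(δ) ≥ δ_½` (`δ ∈ RungSet`; tree: `R*(δ) ≥ δ`, `le_radThreshold_of_lt_threshold`, `radThreshold_jump`);
* `finiteRangeSplitting_iff_window_floor`, `finiteRangeSplitting_iff_rung_two_fifths_floor`,
  `finiteRangeSplitting_iff_rungAtQ_third_floor` — the window / one-instance / rational forms of crux r2 with the
  floor built in, e.g. `FiniteRangeSplitting ↔ ∃ R ≥ δ_½, RungAt (2/5) R ↔ ∃ R ≥ δ_½, RungAtQ (1/3) R`;
* `eInf_le_or_radius_ge_19_20`, `eInf_le_or_radius_ge_97_100` — the conditional stars of `…Star563` / `…Star799`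
  now price the RADIUS: either `e_∞ ≤ -0.7467779`, or every rung at a hard core `δ < 19/20` reads `R ≥ 19/20`
  (resp. `-0.7268672`, `97/100`).

Atlas after this file: every undecided instance `RungAt δ R` has `δ < δ_½ ≤ R` (`δ_½ ∈ [47/50, 6/5]`,
`halfSumThreshold_mem_Icc_47_50_6_5`); those with `δ < 2/5` stand or fall with the line `δ = 2/5`
(`rungAt_of_rungAt_two_fifths`), and crux r2 asks for ONE point `(2/5, R)`, `R ≥ δ_½`, of the region.
-/

noncomputable section

namespace Summit.AtomisticToContinuum.Crystallization.Theorems.StrictSplittingRuleBirth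

open scoped BigOperators Classical Topology
open Filter Literature.MathematicalPhysics.StatisticalMechanics

/-! ## 1. The radius floor -/

/-- Blind-rule averaging needs only the TEST configurations separated beyond the radius: a rung at `(δ, R)` gives
the deepest-site inequality at every hard core `s ≥ δ` with `s > R`. -/
theorem halfSumFeasible_of_rungAt_of_lt {δ R s : ℝ} (hs : 0 < s) (hδs : δ ≤ s) (hRs : R < s)
    (h : RungAt δ R) : HalfSumFeasible s :=
  halfSumFeasible_of_rungAt hs hRs (rungAt_mono_sep hδs h)

/-- … hence `δ_½ ≤ s` for every such `s`. -/
theorem halfSumThreshold_le_of_rungAt {δ R s : ℝ} (hs : 0 < s) (hδs : δ ≤ s) (hRs : R < s)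
    (h : RungAt δ R) : halfSumThreshold ≤ s :=
  halfSumThreshold_le_of (halfSumFeasible_of_rungAt_of_lt hs hδs hRs h)

/-- **Radius floor.**  A rung at `(δ, R)` with `δ > 0` has `δ_½ ≤ max δ R`: the rung region misses the open
square `(0, δ_½) × [0, δ_½)`. -/
theorem halfSumThreshold_le_max_of_rungAt {δ R : ℝ} (hδ : 0 < δ) (h : RungAt δ R) :
    halfSumThreshold ≤ max δ R :=
  le_of_forall_gt_imp_ge_of_dense fun _ hs =>
    halfSumThreshold_le_of_rungAt (hδ.trans_le ((le_max_left δ R).trans hs.le))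
      ((le_max_left δ R).trans hs.le) ((le_max_right δ R).trans_lt hs) h

/-- Contrapositive: with hard core AND radius below `δ_½` there is no rung (tree: only for `R < δ`,
`not_rungAt_of_lt_threshold`). -/
theorem not_rungAt_of_lt_threshold_of_lt {δ R : ℝ} (hδ : 0 < δ) (hδt : δ < halfSumThreshold)
    (hRt : R < halfSumThreshold) : ¬ RungAt δ R :=
  fun h => absurd (halfSumThreshold_le_max_of_rungAt hδ h) (not_le.mpr (max_lt hδt hRt))

/-- **Below the half-rule threshold every rung reads radius `R ≥ δ_½`** (tree: `R ≥ δ`, `radius_ge_of_rungAt`). -/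
theorem threshold_le_radius_of_rungAt {δ R : ℝ} (hδ : 0 < δ) (hδt : δ < halfSumThreshold)
    (h : RungAt δ R) : halfSumThreshold ≤ R :=
  not_lt.mp fun hRt => not_rungAt_of_lt_threshold_of_lt hδ hδt hRt h

/-- … in particular `R ≥ 47/50` (tree: only for `δ ≤ 47/50`, `not_rungAt_47_50`). -/
theorem radius_ge_47_50_of_rungAt {δ R : ℝ} (hδ : 0 < δ) (hδt : δ < halfSumThreshold) (h : RungAt δ R) :
    (47 : ℝ) / 50 ≤ R :=
  le_halfSumThreshold_47_50.trans (threshold_le_radius_of_rungAt hδ hδt h)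

/-- Dichotomy form: a rung at `(δ, R)`, `δ > 0`, has `δ ≥ δ_½` (and then the half rule carries it at every radius,
`rungAt_of_threshold_le`) or `R ≥ δ_½`. -/
theorem threshold_le_or_of_rungAt {δ R : ℝ} (hδ : 0 < δ) (h : RungAt δ R) :
    halfSumThreshold ≤ δ ∨ halfSumThreshold ≤ R :=
  (le_or_gt halfSumThreshold δ).imp_right fun hlt => threshold_le_radius_of_rungAt hδ hlt h

/-- The rung region, decided off the half-strip `{δ < δ_½ ≤ R}`: for `δ > 0`, `RungAt δ R` holds if `δ ≥ δ_½` and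
fails if `max δ R < δ_½`. -/
theorem rungAt_decided_floor {δ : ℝ} (hδ : 0 < δ) (R : ℝ) :
    (halfSumThreshold ≤ δ → RungAt δ R) ∧ (δ < halfSumThreshold → R < halfSumThreshold → ¬ RungAt δ R) :=
  ⟨fun h => rungAt_of_threshold_le h R, not_rungAt_of_lt_threshold_of_lt hδ⟩

/-! ## 2. The hard-core threshold `δ*(R)` equals `δ_½` for every `R < δ_½` -/

/-- **Closed form below `δ_½`**: `δ*(R) = δ_½` for every `R < δ_½` (tree: `R < 47/50`,
`sepThreshold_eq_halfSumThreshold_of_lt`). -/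
theorem sepThreshold_eq_halfSumThreshold_of_lt_threshold {R : ℝ} (hR : R < halfSumThreshold) :
    sepThreshold R = halfSumThreshold := by
  refine le_antisymm (sepThreshold_le_halfSumThreshold R) (le_csInf (rungSetAt_nonempty R) fun δ hδ => ?_)
  exact (threshold_le_or_of_rungAt hδ.1 hδ.2).elim id fun h => absurd h (not_le.mpr hR)

/-- `δ*` is constant (`= δ_½`) on `(-∞, δ_½)`. -/
theorem sepThreshold_eq_of_lt_threshold {R R' : ℝ} (hR : R < halfSumThreshold) (hR' : R' < halfSumThreshold) :
    sepThreshold R = sepThreshold R' := by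
  rw [sepThreshold_eq_halfSumThreshold_of_lt_threshold hR, sepThreshold_eq_halfSumThreshold_of_lt_threshold hR']

/-- A threshold strictly below `δ_½` is only possible from radius `δ_½` on. -/
theorem threshold_le_of_sepThreshold_lt {R : ℝ} (h : sepThreshold R < halfSumThreshold) :
    halfSumThreshold ≤ R :=
  not_lt.mp fun hR => absurd (sepThreshold_eq_halfSumThreshold_of_lt_threshold hR) h.ne

/-- `δ*(R) = 0` forces `R ≥ δ_½`. -/
theorem threshold_le_of_sepThreshold_eq_zero {R : ℝ} (h : sepThreshold R = 0) : halfSumThreshold ≤ R :=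
  threshold_le_of_sepThreshold_lt (h.trans_lt halfSumThreshold_pos)

/-- **Crux r2 `↔ ∃ R ≥ δ_½, δ*(R) = 0`** (tree: `∃ R > 0`, `finiteRangeSplitting_iff_exists_sepThreshold_eq_zero`). -/
theorem finiteRangeSplitting_iff_exists_sepThreshold_eq_zero_floor :
    Summit.AtomisticToContinuum.Crystallization.Theses.FreeSplittingCertificates.FiniteRangeSplitting ↔
      ∃ R : ℝ, halfSumThreshold ≤ R ∧ sepThreshold R = 0 := by
  rw [finiteRangeSplitting_iff_exists_sepThreshold_eq_zero]
  exact ⟨fun ⟨R, _, h0⟩ => ⟨R, threshold_le_of_sepThreshold_eq_zero h0, h0⟩,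
    fun ⟨R, hR, h0⟩ => ⟨R, halfSumThreshold_pos.trans_le hR, h0⟩⟩

/-- The failure of crux r2, floor form: `¬ FiniteRangeSplitting ↔ ∀ R ≥ δ_½, 2/5 ≤ δ*(R)` (below `δ_½` the
threshold is `δ_½ ≥ 47/50 > 2/5` anyway). -/
theorem not_finiteRangeSplitting_iff_forall_sepThreshold_ge_floor :
    ¬ Summit.AtomisticToContinuum.Crystallization.Theses.FreeSplittingCertificates.FiniteRangeSplitting ↔
      ∀ R : ℝ, halfSumThreshold ≤ R → 2 / 5 ≤ sepThreshold R := by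
  rw [not_finiteRangeSplitting_iff_forall_sepThreshold_ge]
  refine ⟨fun h R hR => h R (halfSumThreshold_pos.trans_le hR), fun h R _ => ?_⟩
  rcases lt_or_ge R halfSumThreshold with hlt | hle
  · rw [sepThreshold_eq_halfSumThreshold_of_lt_threshold hlt]
    linarith [le_halfSumThreshold_47_50]
  · exact h R hle

/-! ## 3. The minimal rung radius `R*(δ)` takes no value in `(0, δ_½)` -/

/-- **`R*(δ) ≥ δ_½` below `δ_½`**: for `δ ∈ RungSet` with `δ < δ_½`, `δ_½ ≤ R*(δ)` (tree: `δ ≤ R*(δ)`,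
`le_radThreshold_of_lt_threshold`, and `47/50 ≤ R*(δ)` for `δ ≤ 47/50`, `radThreshold_ge_47_50`). -/
theorem threshold_le_radThreshold_of_lt_threshold {δ : ℝ} (hδ : 0 < δ) (hmem : δ ∈ RungSet)
    (hlt : δ < halfSumThreshold) : halfSumThreshold ≤ radThreshold δ :=
  le_csInf ((radSetAt_nonempty_iff hδ).2 hmem) fun _ hR => threshold_le_radius_of_rungAt hδ hlt hR.2

/-- **Dichotomy for `R*`**: `R*(δ) = 0` (iff `δ ≥ δ_½`) or `R*(δ) ≥ δ_½`, for every `δ ∈ RungSet`. -/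
theorem radThreshold_eq_zero_or_threshold_le {δ : ℝ} (hδ : 0 < δ) (hmem : δ ∈ RungSet) :
    radThreshold δ = 0 ∨ halfSumThreshold ≤ radThreshold δ :=
  (le_or_gt halfSumThreshold δ).imp radThreshold_eq_zero_of_threshold_le
    (threshold_le_radThreshold_of_lt_threshold hδ hmem)

/-- `R*(δ) = 0 ↔ δ_½ ≤ δ` on `RungSet`. -/
theorem radThreshold_eq_zero_iff {δ : ℝ} (hδ : 0 < δ) (hmem : δ ∈ RungSet) :
    radThreshold δ = 0 ↔ halfSumThreshold ≤ δ := by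
  refine ⟨fun h => not_lt.mp fun hlt => ?_, radThreshold_eq_zero_of_threshold_le⟩
  have h1 := threshold_le_radThreshold_of_lt_threshold hδ hmem hlt
  rw [h] at h1
  exact absurd h1 (not_le.mpr halfSumThreshold_pos)

/-- `R*(δ) ∉ (0, δ_½)` for `δ ∈ RungSet`. -/
theorem radThreshold_not_mem_Ioo {δ : ℝ} (hδ : 0 < δ) (hmem : δ ∈ RungSet) :
    radThreshold δ ∉ Set.Ioo 0 halfSumThreshold := fun h =>
  (radThreshold_eq_zero_or_threshold_le hδ hmem).elim (fun h0 => h.1.ne' h0) fun hle => (not_le.mpr h.2) hle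

/-- **The jump of `R*` at `δ_½`, sharpened**: `R*(δ_½) = 0`, and `R*(δ) ≥ δ_½ ≥ 47/50` for every `δ ∈ RungSet`
below `δ_½` (tree `radThreshold_jump`: `R*(δ) ≥ δ`). -/
theorem radThreshold_jump_floor :
    radThreshold halfSumThreshold = 0 ∧
    (∀ δ : ℝ, 0 < δ → δ ∈ RungSet → δ < halfSumThreshold → halfSumThreshold ≤ radThreshold δ) ∧
    (47 / 50 : ℝ) ≤ halfSumThreshold :=
  ⟨radThreshold_eq_zero_of_threshold_le le_rfl,
    fun _ hδ hmem hlt => threshold_le_radThreshold_of_lt_threshold hδ hmem hlt, le_halfSumThreshold_47_50⟩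

/-- Under crux r2 (`RungSet = (0, ∞)`): `R*` vanishes on `[δ_½, ∞)` and is `≥ δ_½` on `(0, δ_½)`. -/
theorem radThreshold_profile_of_finiteRangeSplitting
    (h : Summit.AtomisticToContinuum.Crystallization.Theses.FreeSplittingCertificates.FiniteRangeSplitting)
    {δ : ℝ} (hδ : 0 < δ) :
    (halfSumThreshold ≤ δ → radThreshold δ = 0) ∧ (δ < halfSumThreshold → halfSumThreshold ≤ radThreshold δ) :=
  have hmem : δ ∈ RungSet := by rw [finiteRangeSplitting_iff_rungSet_eq.1 h]; exact hδ
  ⟨radThreshold_eq_zero_of_threshold_le, threshold_le_radThreshold_of_lt_threshold hδ hmem⟩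

/-! ## 4. Crux r2 with the floor built in -/

/-- **Window form, floor version**: `FiniteRangeSplitting ↔ ∀ δ ∈ (0, δ_½), ∃ R ≥ δ_½, RungAt δ R` (tree
`finiteRangeSplitting_iff_window`: `R ≥ δ`). -/
theorem finiteRangeSplitting_iff_window_floor :
    Summit.AtomisticToContinuum.Crystallization.Theses.FreeSplittingCertificates.FiniteRangeSplitting ↔
      ∀ δ : ℝ, 0 < δ → δ < halfSumThreshold → ∃ R : ℝ, halfSumThreshold ≤ R ∧ RungAt δ R := by
  rw [finiteRangeSplitting_iff_window]
  refine forall₂_congr fun δ hδ => forall_congr' fun hlt => ⟨?_, ?_⟩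
  · rintro ⟨R, -, hr⟩
    exact ⟨R, threshold_le_radius_of_rungAt hδ hlt hr, hr⟩
  · rintro ⟨R, hR, hr⟩
    exact ⟨R, hlt.le.trans hR, hr⟩

/-- `2/5 < δ_½`. -/
theorem two_fifths_lt_halfSumThreshold : (2 : ℝ) / 5 < halfSumThreshold :=
  lt_of_lt_of_le (by norm_num) le_halfSumThreshold_47_50

/-- **One-instance form, floor version**: `FiniteRangeSplitting ↔ ∃ R ≥ δ_½, RungAt (2/5) R` (tree
`finiteRangeSplitting_iff_rung_two_fifths`: `R > 0`). -/
theorem finiteRangeSplitting_iff_rung_two_fifths_floor :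
    Summit.AtomisticToContinuum.Crystallization.Theses.FreeSplittingCertificates.FiniteRangeSplitting ↔
      ∃ R : ℝ, halfSumThreshold ≤ R ∧ RungAt (2 / 5) R := by
  rw [finiteRangeSplitting_iff_rung_two_fifths]
  exact ⟨fun ⟨R, _, hr⟩ => ⟨R, threshold_le_radius_of_rungAt (by norm_num) two_fifths_lt_halfSumThreshold hr, hr⟩,
    fun ⟨R, hR, hr⟩ => ⟨R, halfSumThreshold_pos.trans_le hR, hr⟩⟩

/-- The floor for RATIONAL rungs: `RungAtQ δ R` at `0 < δ < δ_½` forces `δ_½ ≤ R` (a rational rung is a rung at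
every strictly larger hard core and radius, `rungAt_of_rungAtQ`). -/
theorem threshold_le_radius_of_rungAtQ {δ R : ℝ} (hδ : 0 < δ) (hδt : δ < halfSumThreshold) (h : RungAtQ δ R) :
    halfSumThreshold ≤ R := by
  refine le_of_forall_gt_imp_ge_of_dense fun R' hR' => ?_
  obtain ⟨δ', hδδ', hδ't⟩ := exists_between hδt
  exact threshold_le_radius_of_rungAt (hδ.trans hδδ') hδ't (rungAt_of_rungAtQ hδ hδδ' hR' h)

/-- **Rational one-instance form, floor version**: `FiniteRangeSplitting ↔ ∃ R ≥ δ_½, RungAtQ (1/3) R` (tree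
`finiteRangeSplitting_iff_rungAtQ_third`: `R > 0`). -/
theorem finiteRangeSplitting_iff_rungAtQ_third_floor :
    Summit.AtomisticToContinuum.Crystallization.Theses.FreeSplittingCertificates.FiniteRangeSplitting ↔
      ∃ R : ℝ, halfSumThreshold ≤ R ∧ RungAtQ (1 / 3) R := by
  rw [finiteRangeSplitting_iff_rungAtQ_third]
  exact ⟨fun ⟨R, _, hQ⟩ => ⟨R, threshold_le_radius_of_rungAtQ (by norm_num)
      (lt_trans (by norm_num) two_fifths_lt_halfSumThreshold) hQ, hQ⟩,
    fun ⟨R, hR, hQ⟩ => ⟨R, halfSumThreshold_pos.trans_le hR, hQ⟩⟩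

/-- **Conditional radius floor `19/20`** (`…Star563`): EITHER `e_∞ ≤ -0.7467779`, OR every rung at a hard core
`0 < δ < 19/20` reads radius `R ≥ 19/20`. -/
theorem eInf_le_or_radius_ge_19_20 :
    eInf ≤ -(1493555850 : ℝ) / (2 * 10 ^ 9) ∨
      ∀ δ R : ℝ, 0 < δ → δ < 19 / 20 → RungAt δ R → (19 : ℝ) / 20 ≤ R :=
  eInf_le_or_le_halfSumThreshold_19_20.imp_right fun h _ _ hδ hlt hr =>
    h.trans (threshold_le_radius_of_rungAt hδ (hlt.trans_le h) hr)

/-- **Conditional radius floor `97/100`** (`…Star799`): EITHER `e_∞ ≤ -0.7268672`, OR every rung at a hard core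
`0 < δ < 97/100` reads radius `R ≥ 97/100`. -/
theorem eInf_le_or_radius_ge_97_100 :
    eInf ≤ -(1453734302 : ℝ) / (2 * 10 ^ 9) ∨
      ∀ δ R : ℝ, 0 < δ → δ < 97 / 100 → RungAt δ R → (97 : ℝ) / 100 ≤ R :=
  eInf_le_or_le_halfSumThreshold_97_100.imp_right fun h _ _ hδ hlt hr =>
    h.trans (threshold_le_radius_of_rungAt hδ (hlt.trans_le h) hr)

end Summit.AtomisticToContinuum.Crystallization.Theorems.StrictSplittingRuleBirth

end
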